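import Summits.AtomisticToContinuum.FouriersLaw.Theorems.BondHeatUncertaintySubdiffusiveBondHeatKernelGibbsB

/-!
# Kernel-level Gibbs invariance for the pinned chain, part C: `e^{-H/T}` is an eigenfunction of the reversed kernels

Third of four support files proving clause (a) of `BoundaryEscapeDeficit.BoundaryKernelBasics`
(stmt-AtomisticToContinuum-12239), needed by crux `stmt-AtomisticToContinuum-9120` (line `bath-bond-deficit-integral`,
stub `stub_bathBondReduction`). This part: for a chain with smooth confining potentials, `N ≥ 1`, `T > 0`, the
transition kernels `P̂_t` of the time-reversed Langevin equation (`OscillatorChain.langevinRevKernel`, both baths at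
`T`) satisfy `∫ e^{-H/T} dP̂_t(z,·) = e^{-2γt} e^{-H(z)/T}` (`integral_gibbsDensity_langevinRevKernel`): Dynkin's
identity (`RegularConfinedDrift.sdeKernel_dynkin`) for the compactly supported truncations `e^{-H/T}χ(H/R)`, the
estimate of part B, dominated convergence `R → ∞`, and the linear ODE `Φ' = -2γΦ` solved by
`constant_of_has_deriv_right_zero`.
-/

noncomputable section

open MeasureTheory ProbabilityTheory Filter Topology Set
open scoped NNReal ENNReal

namespace Summit.AtomisticToContinuum.FouriersLaw.Theorems.SubdiffusiveBondHeat

open Literature.MathematicalPhysics.KineticTheory.HeatConduction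
open Literature.MathematicalPhysics.KineticTheory Literature.Probability.Process OscillatorChain

variable {N : ℕ}

/-! ### The Gibbs density is an eigenfunction of the reversed kernels: `P̂_t e^{-H/T} = e^{-2γt} e^{-H/T}` -/

section Eigen

variable {P : OscillatorChain} (hP : P.IsConfining) (N : ℕ) (T_L T_R : ℝ)
include hP

/-- For bounded continuous `g`, `s ↦ ∫ g dP̂_{s⁺}(z, ·)` is continuous (dominated convergence along the
continuous flow of the reversed equation). [folklore] -/
theorem continuous_integral_langevinRevKernel (z : PhaseSpace N) {g : PhaseSpace N → ℝ}
    (hg : Continuous g) {C : ℝ} (hC : ∀ y, ‖g y‖ ≤ C) :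
    Continuous fun s : ℝ => ∫ y, g y ∂(P.langevinRevKernel N T_L T_R s.toNNReal z) := by
  set D := hP.reversedDrift N with hD
  have hv₁ := hP.bathVecL_mem_reversedDrift_noise N T_L
  have hv₂ := hP.bathVecR_mem_reversedDrift_noise N T_R
  have hrep : (fun s : ℝ => ∫ y, g y ∂(P.langevinRevKernel N T_L T_R s.toNNReal z)) = fun s =>
      ∫ w, g (sdeSolMap (fun y => -P.drift N y) (P.bathVecL N T_L) (P.bathVecR N T_R)
        (s.toNNReal : ℝ) z (pairPath w)) ∂wienerPair := by
    funext s
    exact D.toConfinedDrift.integral_sdeKernel hv₁ hv₂ _ z hg.aestronglyMeasurable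
  rw [hrep]
  have hflow_cont : ∀ w, Continuous fun s : ℝ => sdeSolMap (fun y => -P.drift N y) (P.bathVecL N T_L)
      (P.bathVecR N T_R) (s.toNNReal : ℝ) z (pairPath w) :=
    fun w => (D.toConfinedDrift.continuous_sdeSolMap hv₁ hv₂ z (pairPath w)).comp
      (continuous_subtype_val.comp continuous_real_toNNReal)
  have hflow_meas : ∀ s : ℝ, Measurable fun w => sdeSolMap (fun y => -P.drift N y) (P.bathVecL N T_L)
      (P.bathVecR N T_R) (s.toNNReal : ℝ) z (pairPath w) :=
    fun s => D.toConfinedDrift.measurable_sdeSolMap_pairPath_right hv₁ hv₂ _ z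
  exact continuous_of_dominated (fun s => (hg.measurable.comp (hflow_meas s)).aestronglyMeasurable)
    (fun s => Eventually.of_forall fun w => hC _) (integrable_const C)
    (Eventually.of_forall fun w => hg.comp (hflow_cont w))

/-- The reversed kernels are probability measures. [folklore] -/
theorem isProbabilityMeasure_langevinRevKernel (t : ℝ≥0) (z : PhaseSpace N) :
    IsProbabilityMeasure (P.langevinRevKernel N T_L T_R t z) :=
  (hP.isMarkovKernel_langevinRevKernel N T_L T_R t).isProbabilityMeasure z

variable {N} (hU : ContDiff ℝ ((⊤ : ℕ∞) : WithTop ℕ∞) P.U) (hV : ContDiff ℝ ((⊤ : ℕ∞) : WithTop ℕ∞) P.V)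
  (hN : 0 < N) {T : ℝ} (hT : 0 < T)
include hU hV hN hT

/-- **`e^{-H/T}` is an eigenfunction of the reversed transition kernels at equal bath temperatures**:
`∫ e^{-H/T} dP̂_t(z, ·) = e^{-2γt} e^{-H(z)/T}` for all `t ≥ 0`, `z` (smooth confining potentials, `N ≥ 1`,
`T > 0`). Proof: Dynkin's identity for the truncations `ρ_R = e^{-H/T}χ(H/R) ∈ C²_c` of the reversed equation,
`L̂ρ_R = -2γρ_R + O(1/R)` (`revGenerator_truncGibbs_sub_le`), dominated convergence `R → ∞`, and the linear
ODE `Φ' = -2γΦ` for `Φ(t) = P̂_t ρ(z)`. [cite: CuneoEckmannHairerReyBellet2018, §3.1] -/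
theorem integral_gibbsDensity_langevinRevKernel (t : ℝ≥0) (z : PhaseSpace N) :
    ∫ y, P.gibbsDensity N T y ∂(P.langevinRevKernel N T T t z) =
      Real.exp (-(2 * P.γ) * t) * P.gibbsDensity N T z := by
  -- notation and basic facts
  set D := hP.reversedDrift N with hD
  have hv₁ := hP.bathVecL_mem_reversedDrift_noise N T
  have hv₂ := hP.bathVecR_mem_reversedDrift_noise N T
  set κ : ℝ≥0 → Kernel (PhaseSpace N) (PhaseSpace N) := P.langevinRevKernel N T T with hκ
  have hκs : ∀ s, κ s = sdeKernel (fun y => -P.drift N y) (P.bathVecL N T) (P.bathVecR N T) s := fun s => rfl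
  haveI hprob : ∀ s y, IsProbabilityMeasure (κ s y) := fun s y =>
    isProbabilityMeasure_langevinRevKernel hP N T T s y
  set Hm := P.hamiltonian N with hHm
  set ρ : PhaseSpace N → ℝ := P.gibbsDensity N T with hρdef
  have hρ : ρ = fun y => Real.exp (-Hm y / T) := rfl
  have hU2 : ContDiff ℝ 2 P.U := hU.of_le (by norm_cast)
  have hV2 : ContDiff ℝ 2 P.V := hV.of_le (by norm_cast)
  have hH2 : ContDiff ℝ 2 Hm := P.contDiff_hamiltonian hU2 hV2 N
  have hHc : Continuous Hm := hH2.continuous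
  have hH0 : ∀ y, 0 ≤ Hm y := fun y => P.hamiltonian_nonneg_of_nonneg hP.U_nonneg hP.V_nonneg N y
  have hρc : Continuous ρ := by rw [hρ]; fun_prop
  have hρ0 : ∀ y, 0 ≤ ρ y := fun y => (Real.exp_pos _).le
  have hρ1 : ∀ y, ρ y ≤ 1 := fun y => by
    rw [hρ]; dsimp only
    rw [Real.exp_le_one_iff, neg_div]
    exact neg_nonpos.2 (div_nonneg (hH0 y) hT.le)
  have hρn : ∀ y, ‖ρ y‖ ≤ 1 := fun y => by rw [Real.norm_of_nonneg (hρ0 y)]; exact hρ1 y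
  -- the truncations
  set ρR : ℕ → PhaseSpace N → ℝ := fun n y => Real.exp (-Hm y / T) * smoothCutoff (Hm y / (n + 1)) with hρR
  have hRpos : ∀ n : ℕ, (0:ℝ) < n + 1 := fun n => by positivity
  have hρR2 : ∀ n, ContDiff ℝ 2 (ρR n) := fun n => by
    have h1 : ContDiff ℝ 2 fun y => Real.exp (-Hm y / T) := (hH2.neg.div_const T).exp
    have h2 : ContDiff ℝ 2 fun y => smoothCutoff (Hm y / (n + 1)) :=
      (contDiff_smoothCutoff (n := 2)).comp (hH2.div_const _)
    exact h1.mul h2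
  have hρRc : ∀ n, Continuous (ρR n) := fun n => (hρR2 n).continuous
  have hρRsupp : ∀ n, HasCompactSupport (ρR n) := fun n => by
    refine HasCompactSupport.intro (hP.isCompact_setOf_hamiltonian_le N (2 * (n + 1))) fun y hy => ?_
    simp only [mem_setOf_eq, not_le] at hy
    have h2 : 2 ≤ Hm y / (n + 1) := by rw [le_div_iff₀ (hRpos n)]; linarith
    show Real.exp (-Hm y / T) * smoothCutoff (Hm y / (n + 1)) = 0
    rw [smoothCutoff_of_two_le h2, mul_zero]
  have hρR0 : ∀ n y, 0 ≤ ρR n y := fun n y => mul_nonneg (Real.exp_pos _).le (smoothCutoff_nonneg _)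
  have hρRle : ∀ n y, ρR n y ≤ ρ y := fun n y => by
    rw [hρ]
    exact mul_le_of_le_one_right (Real.exp_pos _).le (smoothCutoff_le_one _)
  have hρRn : ∀ n y, ‖ρR n y‖ ≤ 1 := fun n y => by
    rw [Real.norm_of_nonneg (hρR0 n y)]; exact (hρRle n y).trans (hρ1 y)
  have hρRlim : ∀ y, Tendsto (fun n => ρR n y) atTop (𝓝 (ρ y)) := fun y => by
    refine tendsto_const_nhds.congr' ?_
    obtain ⟨n₀, hn₀⟩ := exists_nat_ge (Hm y)
    filter_upwards [eventually_ge_atTop n₀] with n hn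
    have h1 : Hm y / (n + 1) ≤ 1 := by
      rw [div_le_one (hRpos n)]
      have : (n₀ : ℝ) ≤ n := by exact_mod_cast hn
      linarith
    show ρ y = Real.exp (-Hm y / T) * smoothCutoff (Hm y / (n + 1))
    rw [smoothCutoff_of_le_one h1, mul_one, hρ]
  -- the generator error
  obtain ⟨C, hC⟩ := revGenerator_truncGibbs_sub_le hU2 hV2 hP.U_nonneg hP.V_nonneg hN hP.γ_nonneg hT
  set L := sdeGenerator (fun y => -P.drift N y) (P.bathVecL N T) (P.bathVecR N T) with hL
  set eR : ℕ → PhaseSpace N → ℝ := fun n y => L (ρR n) y + 2 * P.γ * ρR n y with heR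
  have heRb : ∀ n y, |eR n y| ≤ C / (n + 1) := fun n y => by
    have := hC (n + 1) (by linarith [(n.cast_nonneg : (0:ℝ) ≤ n)]) y
    exact this
  have hC0 : 0 ≤ C := by
    have := (abs_nonneg _).trans (heRb 0 z)
    simpa using this
  have hYc : Continuous fun y => -P.drift N y := D.contDiff_drift.continuous
  have heRc : ∀ n, Continuous (eR n) := fun n =>
    (continuous_sdeGenerator _ _ hYc (hρR2 n)).add (continuous_const.mul (hρRc n))
  have hLρR : ∀ n y, L (ρR n) y = -(2 * P.γ) * ρR n y + eR n y := fun n y => by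
    simp only [heR]; ring
  -- kernel integrals as functions of real time
  set Φ : ℝ → ℝ := fun s => ∫ y, ρ y ∂(κ s.toNNReal z) with hΦ
  set ΦR : ℕ → ℝ → ℝ := fun n s => ∫ y, ρR n y ∂(κ s.toNNReal z) with hΦR
  set ER : ℕ → ℝ → ℝ := fun n s => ∫ y, eR n y ∂(κ s.toNNReal z) with hER
  have hΦc : Continuous Φ := continuous_integral_langevinRevKernel hP N T T z hρc hρn
  have hΦRc : ∀ n, Continuous (ΦR n) := fun n => continuous_integral_langevinRevKernel hP N T T z (hρRc n) (hρRn n)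
  have hERc : ∀ n, Continuous (ER n) := fun n =>
    continuous_integral_langevinRevKernel hP N T T z (heRc n) (C := C / (n + 1)) fun y => by
      rw [Real.norm_eq_abs]; exact heRb n y
  have hΦRle : ∀ n s, |ΦR n s| ≤ 1 := fun n s => by
    have := norm_integral_le_of_norm_le_const (μ := κ s.toNNReal z) (Eventually.of_forall (hρRn n))
    simpa [probReal_univ] using this
  have hERle : ∀ n s, |ER n s| ≤ C / (n + 1) := fun n s => by
    have := norm_integral_le_of_norm_le_const (μ := κ s.toNNReal z)
      (Eventually.of_forall (fun y => show ‖eR n y‖ ≤ C / (n + 1) by rw [Real.norm_eq_abs]; exact heRb n y))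
    simpa [probReal_univ] using this
  -- Dynkin for the truncations: `ΦR n u - ρR n z = ∫₀ᵘ (-2γ ΦR n s + ER n s) ds`, `u ≥ 0`
  have hdyn : ∀ (n : ℕ) (u : ℝ), 0 ≤ u → ΦR n u - ρR n z = ∫ s in (0:ℝ)..u, (-(2 * P.γ) * ΦR n s + ER n s) := by
    intro n u hu
    have h := D.sdeKernel_dynkin hv₁ hv₂ (hρR2 n) (hρRsupp n) u.toNNReal z
    rw [Real.coe_toNNReal _ hu, ← hκs] at h
    simp only [hΦR, hER]
    rw [h]
    refine intervalIntegral.integral_congr fun s _ => ?_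
    rw [← hκs]
    have hint1 : Integrable (ρR n) (κ s.toNNReal z) :=
      (integrable_const 1).mono' (hρRc n).aestronglyMeasurable (Eventually.of_forall (hρRn n))
    have hint2 : Integrable (eR n) (κ s.toNNReal z) :=
      (integrable_const (C / (n + 1))).mono' (heRc n).aestronglyMeasurable
        (Eventually.of_forall fun y => by rw [Real.norm_eq_abs]; exact heRb n y)
    have e1 : (fun y => L (ρR n) y) = fun y => -(2 * P.γ) * ρR n y + eR n y := funext (hLρR n)
    show ∫ y, L (ρR n) y ∂(κ s.toNNReal z) = -(2 * P.γ) * ∫ y, ρR n y ∂(κ s.toNNReal z) + ∫ y, eR n y ∂(κ s.toNNReal z)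
    rw [e1, integral_add (hint1.const_mul _) hint2, integral_const_mul]
  -- pass to the limit `n → ∞` in Dynkin's identity
  have hlim : ∀ u : ℝ, 0 ≤ u → Φ u - ρ z = ∫ s in (0:ℝ)..u, (-(2 * P.γ) * Φ s) := by
    intro u hu
    have hL1 : Tendsto (fun n => ΦR n u - ρR n z) atTop (𝓝 (Φ u - ρ z)) := by
      refine Tendsto.sub ?_ (hρRlim z)
      simp only [hΦR, hΦ]
      exact tendsto_integral_of_dominated_convergence (fun _ => 1)
        (fun n => (hρRc n).aestronglyMeasurable) (integrable_const 1)
        (fun n => Eventually.of_forall (hρRn n)) (Eventually.of_forall hρRlim)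
    have hL2 : Tendsto (fun n => ∫ s in (0:ℝ)..u, (-(2 * P.γ) * ΦR n s + ER n s)) atTop
        (𝓝 (∫ s in (0:ℝ)..u, (-(2 * P.γ) * Φ s))) := by
      refine intervalIntegral.tendsto_integral_filter_of_dominated_convergence (fun _ => 2 * P.γ + C) ?_ ?_
        ?_ ?_
      · exact Eventually.of_forall fun n =>
          ((continuous_const.mul (hΦRc n)).add (hERc n)).aestronglyMeasurable
      · refine Eventually.of_forall fun n => Eventually.of_forall fun s _ => ?_
        have h1 := hΦRle n s
        have h2 := hERle n s
        have h3 : C / (n + 1) ≤ C := div_le_self hC0 (by linarith [(n.cast_nonneg : (0:ℝ) ≤ n)])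
        rw [Real.norm_eq_abs]
        calc |-(2 * P.γ) * ΦR n s + ER n s| ≤ |-(2 * P.γ) * ΦR n s| + |ER n s| := abs_add_le _ _
          _ = 2 * P.γ * |ΦR n s| + |ER n s| := by
              rw [abs_mul, abs_neg, abs_of_nonneg (by linarith [hP.γ_nonneg])]
          _ ≤ 2 * P.γ * 1 + C := add_le_add (mul_le_mul_of_nonneg_left h1 (by linarith [hP.γ_nonneg]))
              (h2.trans h3)
          _ = 2 * P.γ + C := by ring
      · exact intervalIntegrable_const
      · refine Eventually.of_forall fun s _ => ?_
        have hA : Tendsto (fun n => ΦR n s) atTop (𝓝 (Φ s)) := by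
          simp only [hΦR, hΦ]
          exact tendsto_integral_of_dominated_convergence (fun _ => 1)
            (fun n => (hρRc n).aestronglyMeasurable) (integrable_const 1)
            (fun n => Eventually.of_forall (hρRn n)) (Eventually.of_forall hρRlim)
        have hB : Tendsto (fun n => ER n s) atTop (𝓝 0) := by
          have hCn : Tendsto (fun n : ℕ => C / (n + 1)) atTop (𝓝 0) :=
            tendsto_const_nhds.div_atTop (tendsto_natCast_atTop_atTop.atTop_add tendsto_const_nhds)
          exact squeeze_zero_norm (fun n => by rw [Real.norm_eq_abs]; exact hERle n s) hCn
        have := (hA.const_mul (-(2 * P.γ))).add hB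
        simpa using this
    have hEq : (fun n => ΦR n u - ρR n z) = fun n => ∫ s in (0:ℝ)..u, (-(2 * P.γ) * ΦR n s + ER n s) :=
      funext fun n => hdyn n u hu
    rw [hEq] at hL1
    exact tendsto_nhds_unique hL1 hL2
  -- solve the linear ODE: `e^{2γs} Φ(s)` is constant on `[0, t]`
  have hΦ0 : Φ 0 = ρ z := sub_eq_zero.1 (by simpa using hlim 0 le_rfl)
  have key : ∀ x ∈ Icc (0:ℝ) t, Real.exp (2 * P.γ * x) * Φ x = Real.exp (2 * P.γ * 0) * Φ 0 := by
    refine constant_of_has_deriv_right_zero ?_ ?_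
    · exact ((Real.continuous_exp.comp (continuous_const.mul continuous_id)).mul hΦc).continuousOn
    · intro x hx
      have hx0 : 0 ≤ x := hx.1
      -- `Φ` agrees on `[0, ∞)` with `Ψ(s) = ρ z - 2γ ∫₀ˢ Φ`, which is differentiable
      have hΨ : HasDerivAt (fun s => ρ z + ∫ r in (0:ℝ)..s, (-(2 * P.γ) * Φ r)) (-(2 * P.γ) * Φ x) x := by
        have hc2 : Continuous (fun r => -(2 * P.γ) * Φ r) := continuous_const.mul hΦc
        exact (hc2.integral_hasStrictDerivAt 0 x).hasDerivAt.const_add (ρ z)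
      have hΦd : HasDerivWithinAt Φ (-(2 * P.γ) * Φ x) (Ici x) x := by
        refine hΨ.hasDerivWithinAt.congr (fun y hy => ?_) ?_
        · have := hlim y (hx0.trans hy)
          linarith
        · have := hlim x hx0
          linarith
      have hexp : HasDerivWithinAt (fun s => Real.exp (2 * P.γ * s)) (Real.exp (2 * P.γ * x) * (2 * P.γ))
          (Ici x) x := by
        have h1 : HasDerivAt (fun s : ℝ => 2 * P.γ * s) (2 * P.γ) x := by
          simpa using (hasDerivAt_id x).const_mul (2 * P.γ)
        exact h1.exp.hasDerivWithinAt
      have := hexp.mul hΦd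
      refine this.congr_deriv ?_
      ring
  have hfin := key t ⟨t.coe_nonneg, le_rfl⟩
  rw [mul_zero, Real.exp_zero, one_mul, hΦ0] at hfin
  have hΦt : Φ t = ∫ y, ρ y ∂(κ t z) := by simp only [hΦ, Real.toNNReal_coe]
  rw [← hΦt]
  have hexp : Real.exp (-(2 * P.γ) * t) * Real.exp (2 * P.γ * t) = 1 := by
    rw [← Real.exp_add]; simp
  calc Φ t = Real.exp (-(2 * P.γ) * t) * (Real.exp (2 * P.γ * t) * Φ t) := by
        rw [← mul_assoc, hexp, one_mul]
    _ = Real.exp (-(2 * P.γ) * t) * ρ z := by rw [hfin]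

end Eigen

end Summit.AtomisticToContinuum.FouriersLaw.Theorems.SubdiffusiveBondHeat

end
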